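import Summits.QuantumFields.YangMills.Theses.ContractibleFibre
import Literature.MathematicalPhysics.QuantumFieldTheory.FreeTubeSlabCovariance
import Summits.QuantumFields.YangMills.Theorems.ContractibleFibreFibreAnchorTraceFormulaClustering

/-!
# Stub S2b — time-slicing of the free tube (packaging)

Stub `stub_tracePackaging` of line `trace-vdr` (skeleton `Cruxes/FibreAnchor/Lines/trace_vdr.lean`, lead reshape r1)
for crux `FibreAnchor` (stmt-QuantumFields-16243), route `ContractibleFibre` of `QuantumFields/YangMills`:
(S2a as hypothesis) → VDR on the free tubes of width `M` at coupling `β ≥ 0` → the crux clustering clause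
`Tube M β (m₀/2) C' w Lmin'`.  Proof (Osterwalder–Seiler / Lüscher time slicing; tree files
`Literature/Analysis/OperatorTheory/CyclicChainCondExp`,
`Literature/MathematicalPhysics/QuantumFieldTheory/FreeTube{SliceAssembly,TransferKernel,SlabCovariance}`): the marginal
law of the spatial slices of the free tube is the cyclic chain of the symmetrised slice kernel `K` (measurable, bounded, non-negative, symmetric, of positive type for
`β ≥ 0`), whose cyclic partition functions are the tube partition functions of the VDR hypothesis for every time period;
given the slices the temporal layers are conditionally independent, so tube covariances of `[c, c+w]`-slab observables
at time distance `n > w` are chain covariances of their conditional expectations, which are `[c, c+w+1]`-slab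
observables of the chain bounded by `1`; S2a applies with `E = max C 0 · L`, `N = L`, width `w + 1` once
`(4/m₀) log(2 + max C 0 · L) + 4(w+2) ≤ L`; for `n ≤ w` the bound is the trivial `2 ≤ 2 e^{m₀ w/2} e^{-m₀ n/2}`.
References: K. Osterwalder, E. Seiler, Ann. Phys. 110 (1978) 440, §2; E. Seiler, LNP 159 (1982) Ch. 2;
M. Lüscher, Commun. Math. Phys. 54 (1977) 283.
-/

set_option autoImplicit false

noncomputable section

namespace Summit.QuantumFields.YangMills.Cruxes.FibreAnchor.TraceVDR

open scoped BigOperators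
open MeasureTheory
open Summit.QuantumFields.YangMills.Theses.ContractibleFibre Literature.MathematicalPhysics.QuantumFieldTheory

/-- **Time-slicing of the free tube, conditional form** (wave-1 cut of stub S2b of line `trace-vdr`, crux
`FibreAnchor`): the abstract trace-formula clustering theorem (statement of `stub_traceFormulaClustering`, as a
hypothesis) and vacuum dominance with a rate on the free tubes of width `M` at coupling `β ≥ 0` give the crux's
clustering clause at rate `m₀/2`. See the skeleton `Cruxes/FibreAnchor/Lines/trace_vdr.lean` for the informal
statement and proof plan. [cite: OsterwalderSeiler1978, §2] [cite: Seiler1982, Ch. 2] -/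
theorem stub_tracePackaging_of_traceFormulaClustering :
    (∀ (X : Type) [MeasurableSpace X] (μ : MeasureTheory.Measure X) [MeasureTheory.IsProbabilityMeasure μ] (K : X → X → ℝ), Measurable (Function.uncurry K) → (∃ B : ℝ, ∀ x y, K x y ≤ B) → (∀ x y, 0 ≤ K x y) → (∀ x y, K x y = K y x) → (∀ f : X → ℝ, Measurable f → (∀ x, |f x| ≤ 1) → 0 ≤ ∫ x, (∫ y, f x * K x y * f y ∂μ) ∂μ) → ∀ (m₀ E : ℝ) (w N : ℕ) [NeZero N], 0 < m₀ → 0 ≤ E → 4 / m₀ * Real.log (2 + E) + 4 * (w + 1) ≤ (N : ℝ) → let Zc : ℕ → ℝ := fun j => ∫ V : ZMod (j + 1) → X, ∏ t, K (V t) (V (t + 1)) ∂(MeasureTheory.Measure.pi fun _ => μ); (∃ lam : ℝ, 0 < lam ∧ (∀ j : ℕ, 1 ≤ j → lam ^ (j + 1) ≤ Zc j) ∧ ∀ j : ℕ, 1 ≤ j → j + 1 ≤ N → Zc j ≤ lam ^ (j + 1) * Real.exp (E * Real.exp (-(m₀ * (j + 1))))) → let Ex : ((ZMod N → X) → ℝ)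 → ℝ := fun F => (∫ V, F V * ∏ t, K (V t) (V (t + 1)) ∂(MeasureTheory.Measure.pi fun _ => μ)) / (∫ V : ZMod N → X, ∏ t, K (V t) (V (t + 1)) ∂(MeasureTheory.Measure.pi fun _ => μ)); let σ : ℕ → (ZMod N → X) → (ZMod N → X) := fun n V t => V (t + n); ∀ c : ZMod N, let Loc := fun F : (ZMod N → X) → ℝ => Measurable F ∧ (∀ V, |F V| ≤ 1) ∧ ∀ V V', (∀ t : ZMod N, (t - c).val ≤ w → V t = V' t) → F V = F V'; ∀ F₁ F₂ : (ZMod N → X) → ℝ, Loc F₁ → Loc F₂ → ∀ n : ℕ, 2 * n < N → |Ex (fun V => F₁ V * F₂ (σ n V)) - Ex F₁ * Ex (fun V => F₂ (σ n V))| ≤ 64 * Real.exp (m₀ * (w + 1)) * Real.exp (-(m₀ / 2 * n))) → ∀ (G : Type) [Group G] [TopologicalSpace G] [IsTopologicalGroup G] [CompactSpace G], Literature.MathematicalPhysics.QuantumFieldTheory.IsCompactSimpleLieGroup G → letI : MeasurableSpace G := borel G; haveI : BorelSpace G := ⟨rfl⟩; ∀ r : Literature.MathematicalPhysics.QuantumFieldTheory.LatticeRep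 G, let Tube := fun (M : ℕ) (β m C : ℝ) (w Lmin : ℕ) => ∀ (L : ℕ) [NeZero L], Lmin ≤ L → let St := ZMod L × ZMod L × Fin (M + 1) × Fin (M + 1); let Cfg := St × Fin 4 → G; let ν : MeasureTheory.Measure Cfg := MeasureTheory.Measure.pi fun _ => Literature.MathematicalPhysics.QuantumFieldTheory.haarProbability G; let sh : St → Fin 4 → St := fun x μ => ![(x.1 + 1, x.2.1, x.2.2.1, x.2.2.2), (x.1, x.2.1 + 1, x.2.2.1, x.2.2.2), (x.1, x.2.1, x.2.2.1 + 1, x.2.2.2), (x.1, x.2.1, x.2.2.1, x.2.2.2 + 1)] μ; let ins : St → Fin 4 → Fin 4 → ℝ := fun x μ κ => if ((μ = 2 ∨ κ = 2) → (x.2.2.1 : ℕ) < M) ∧ ((μ = 3 ∨ κ = 3) → (x.2.2.2 : ℕ) < M) then 1 else 0; let pl : Cfg → St → Fin 4 → Fin 4 → G := fun U x μ κ => U (x, μ) * U (sh x μ, κ) * (U (sh x κ, μ))⁻¹ * (U (x, κ))⁻¹; let act : Cfg → ℝ := fun U => β * ∑ x : St, ∑ q : {q : Fin 4 × Fin 4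 // q.1 < q.2}, ins x q.1.1 q.1.2 * (r.ρ (pl U x q.1.1 q.1.2)).trace.re; let wgt : Cfg → ℝ := fun U => Real.exp (act U); let Ex : (Cfg → ℝ) → ℝ := fun F => (∫ U, F U * wgt U ∂ν) / (∫ U, wgt U ∂ν); let σ : ℕ → Cfg → Cfg := fun n U p => U ((p.1.1 + n, p.1.2), p.2); ∀ c : ZMod L, let Loc := fun F : Cfg → ℝ => Measurable F ∧ (∀ U, |F U| ≤ 1) ∧ ∀ U U', (∀ p : St × Fin 4, (p.1.1 - c).val ≤ w → U p = U' p) → F U = F U'; ∀ F₁ F₂ : Cfg → ℝ, Loc F₁ → Loc F₂ → ∀ n : ℕ, 2 * n < L → |Ex (fun U => F₁ U * F₂ (σ n U)) - Ex F₁ * Ex (fun U => F₂ (σ n U))| ≤ C * Real.exp (-(m * n)); let VDR := fun (M : ℕ) (β m₀ C : ℝ) (Lmin : ℕ) => ∀ (L : ℕ) [NeZero L], Lmin ≤ L → let Zt : ℕ → ℝ := fun j => let St := ZMod (j + 1) × ZMod L × Fin (M + 1) × Fin (M + 1); let Cfg := St × Fin 4 → G; let ν : MeasureTheory.Measure Cfg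 := MeasureTheory.Measure.pi fun _ => Literature.MathematicalPhysics.QuantumFieldTheory.haarProbability G; let sh : St → Fin 4 → St := fun x μ => ![(x.1 + 1, x.2.1, x.2.2.1, x.2.2.2), (x.1, x.2.1 + 1, x.2.2.1, x.2.2.2), (x.1, x.2.1, x.2.2.1 + 1, x.2.2.2), (x.1, x.2.1, x.2.2.1, x.2.2.2 + 1)] μ; let ins : St → Fin 4 → Fin 4 → ℝ := fun x μ κ => if ((μ = 2 ∨ κ = 2) → (x.2.2.1 : ℕ) < M) ∧ ((μ = 3 ∨ κ = 3) → (x.2.2.2 : ℕ) < M) then 1 else 0; let pl : Cfg → St → Fin 4 → Fin 4 → G := fun U x μ κ => U (x, μ) * U (sh x μ, κ) * (U (sh x κ, μ))⁻¹ * (U (x, κ))⁻¹; let act : Cfg → ℝ := fun U => β * ∑ x : St, ∑ q : {q : Fin 4 × Fin 4 // q.1 < q.2}, ins x q.1.1 q.1.2 * (r.ρ (pl U x q.1.1 q.1.2)).trace.re; ∫ U, Real.exp (act U) ∂ν; ∃ lam : ℝ, 0 < lam ∧ (∀ j : ℕ, 1 ≤ j → lam ^ (j + 1) ≤ Zt j)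 ∧ ∀ j : ℕ, 1 ≤ j → j + 1 ≤ L → Zt j ≤ lam ^ (j + 1) * Real.exp (C * (L : ℝ) * Real.exp (-(m₀ * (j + 1)))); ∀ (M : ℕ) (β m₀ C : ℝ) (Lmin : ℕ), 0 ≤ β → 0 < m₀ → VDR M β m₀ C Lmin → ∀ w : ℕ, ∃ C' : ℝ, ∃ Lmin' : ℕ, Tube M β (m₀ / 2) C' w Lmin' := by
  intro hS2a G _ _ _ _ hG
  letI : MeasurableSpace G := borel G
  haveI : BorelSpace G := ⟨rfl⟩
  intro r Tube VDR M β m₀ C Lmin hβ hm₀ hVDR w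
  haveI : SecondCountableTopology G :=
    (r.continuous.isClosedEmbedding r.injective).isEmbedding.secondCountableTopology
  -- the constants: `C' = max (64 e^{m₀ (w+2)}) (2 e^{m₀ w/2})`, `Lmin' = max Lmin L₁` with the period threshold `L₁`
  obtain ⟨L₁, hL₁⟩ := FreeTube.exists_nat_log_threshold m₀ hm₀ (max C 0) (le_max_right _ _)
    (4 * (((w + 1 : ℕ) : ℝ) + 1))
  refine ⟨max (64 * Real.exp (m₀ * (((w + 1 : ℕ) : ℝ) + 1))) (2 * Real.exp (m₀ / 2 * w)), max Lmin L₁, ?_⟩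
  intro L _ hL St Cfg ν sh ins pl act wgt Ex σ c Loc F₁ F₂ hF₁ hF₂ n hn
  have hLmin : Lmin ≤ L := (le_max_left _ _).trans hL
  have hLL₁ : L₁ ≤ L := (le_max_right _ _).trans hL
  obtain ⟨hF₁m, hF₁b, hF₁l⟩ := hF₁
  obtain ⟨hF₂m, hF₂b, hF₂l⟩ := hF₂
  -- objects of one time slice (independent of the time period): spatial shift, free-face indicator, slice and layer
  -- energies, the symmetrised slice kernel `K` and the normalised layer density `q`
  obtain ⟨shS, hshS⟩ : ∃ shS : ZMod L × Fin (M + 1) × Fin (M + 1) → Fin 3 → ZMod L × Fin (M + 1) × Fin (M + 1),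
      ∀ s i, shS s i = ![(s.1 + 1, s.2.1, s.2.2), (s.1, s.2.1 + 1, s.2.2), (s.1, s.2.1, s.2.2 + 1)] i :=
    ⟨_, fun _ _ => rfl⟩
  obtain ⟨insS, hinsS⟩ : ∃ insS : ZMod L × Fin (M + 1) × Fin (M + 1) → Fin 4 → Fin 4 → ℝ, ∀ s μ κ, insS s μ κ =
      if ((μ = 2 ∨ κ = 2) → (s.2.1 : ℕ) < M) ∧ ((μ = 3 ∨ κ = 3) → (s.2.2 : ℕ) < M) then 1 else 0 :=
    ⟨_, fun _ _ _ => rfl⟩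
  obtain ⟨Ssp, hSsp⟩ : ∃ Ssp : ((ZMod L × Fin (M + 1) × Fin (M + 1)) × Fin 3 → G) → ℝ, ∀ a, Ssp a =
      β * ∑ s, ∑ i : Fin 3, ∑ j : Fin 3, if i < j then insS s i.succ j.succ *
        (r.ρ (a (s, i) * a (shS s i, j) * (a (shS s j, i))⁻¹ * (a (s, j))⁻¹)).trace.re else 0 := ⟨_, fun _ => rfl⟩
  obtain ⟨Stm, hStm⟩ : ∃ Stm : ((ZMod L × Fin (M + 1) × Fin (M + 1)) × Fin 3 → G) →
      (ZMod L × Fin (M + 1) × Fin (M + 1) → G) → ((ZMod L × Fin (M + 1) × Fin (M + 1)) × Fin 3 → G) → ℝ,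
      ∀ a e b, Stm a e b = β * ∑ s, ∑ j : Fin 3, insS s 0 j.succ *
        (r.ρ (e s * b (s, j) * (e (shS s j))⁻¹ * (a (s, j))⁻¹)).trace.re := ⟨_, fun _ _ _ => rfl⟩
  obtain ⟨K, hK⟩ : ∃ K : ((ZMod L × Fin (M + 1) × Fin (M + 1)) × Fin 3 → G) →
      ((ZMod L × Fin (M + 1) × Fin (M + 1)) × Fin 3 → G) → ℝ, ∀ a b, K a b = Real.exp (Ssp a / 2) *
        (∫ e, Real.exp (Stm a e b) ∂(Measure.pi fun _ : ZMod L × Fin (M + 1) × Fin (M + 1) =>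
          Literature.MathematicalPhysics.QuantumFieldTheory.haarProbability G)) * Real.exp (Ssp b / 2) :=
    ⟨_, fun _ _ => rfl⟩
  obtain ⟨q, hq⟩ : ∃ q : ((ZMod L × Fin (M + 1) × Fin (M + 1)) × Fin 3 → G) →
      (ZMod L × Fin (M + 1) × Fin (M + 1) → G) → ((ZMod L × Fin (M + 1) × Fin (M + 1)) × Fin 3 → G) → ℝ,
      ∀ a e b, q a e b = Real.exp (Stm a e b) / ∫ e', Real.exp (Stm a e' b)
        ∂(Measure.pi fun _ : ZMod L × Fin (M + 1) × Fin (M + 1) =>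
          Literature.MathematicalPhysics.QuantumFieldTheory.haarProbability G) := ⟨_, fun _ _ _ => rfl⟩
  have hinsS01 : ∀ s μ κ, insS s μ κ = 0 ∨ insS s μ κ = 1 := fun s μ κ => by
    rw [hinsS]; split_ifs <;> simp
  -- the five kernel hypotheses of S2a
  have hKm := FreeTube.measurable_uncurry_K r.ρ β shS insS Ssp hSsp Stm hStm K hK r.continuous
  have hKb := FreeTube.exists_K_le r.ρ β shS insS Ssp hSsp Stm hStm K hK r.continuous
  have hK0 := FreeTube.K_nonneg Ssp Stm K hK
  have hKs := FreeTube.K_symm r.ρ β shS insS Ssp Stm hStm K hK r.mem_unitary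
  have hKp := FreeTube.posType_K r.ρ β shS insS hinsS01 Ssp hSsp Stm hStm K hK r.continuous r.mem_unitary hβ
  -- the assembling map of the tube of time period `L`, its partition function, the trivial bound
  obtain ⟨asm, hasm⟩ : ∃ asm : (ZMod L → (ZMod L × Fin (M + 1) × Fin (M + 1)) × Fin 3 → G) ×
      (ZMod L → ZMod L × Fin (M + 1) × Fin (M + 1) → G) → Cfg,
      ∀ p e, asm p e = (Fin.cons (p.2 e.1.1 e.1.2) (fun i : Fin 3 => p.1 e.1.1 (e.1.2, i)) : Fin 4 → G) e.2 :=
    ⟨_, fun _ _ => rfl⟩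
  have hsh0 : ∀ (t : ZMod L) (s : ZMod L × Fin (M + 1) × Fin (M + 1)), sh (t, s) 0 = (t + 1, s) := fun _ _ => rfl
  have hshs : ∀ (t : ZMod L) (s : ZMod L × Fin (M + 1) × Fin (M + 1)) (j : Fin 3), sh (t, s) j.succ = (t, shS s j) :=
    fun t s j => by rw [hshS]; fin_cases j <;> rfl
  have hins : ∀ (t : ZMod L) (s : ZMod L × Fin (M + 1) × Fin (M + 1)) (μ κ : Fin 4), ins (t, s) μ κ = insS s μ κ :=
    fun t s μ κ => by rw [hinsS]
  have hZ : ∫ U, wgt U ∂ν = ∫ V, ∏ t, K (V t) (V (t + 1)) ∂(Measure.pi fun _ : ZMod L => Measure.pi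
      fun _ : (ZMod L × Fin (M + 1) × Fin (M + 1)) × Fin 3 => Literature.MathematicalPhysics.QuantumFieldTheory.haarProbability G) :=
    FreeTube.integral_exp_act_eq r.ρ β shS sh hsh0 hshs ins insS hins pl (fun _ _ _ _ => rfl) act (fun _ => rfl) asm hasm
      Ssp hSsp Stm hStm K hK q hq r.continuous
  have hZpos : 0 < ∫ U, wgt U ∂ν :=
    FreeTube.integral_exp_act_pos r.ρ β sh ins pl (fun _ _ _ _ => rfl) act (fun _ => rfl) r.continuous
  have hEx1 : ∀ Φ : Cfg → ℝ, (∀ U, |Φ U| ≤ 1) → |Ex Φ| ≤ 1 := fun Φ hΦ => by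
    show |(∫ U, Φ U * wgt U ∂ν) / ∫ U, wgt U ∂ν| ≤ 1
    rw [abs_div, abs_of_pos hZpos, div_le_one hZpos]
    exact FreeTube.abs_integral_mul_exp_act_le r.ρ β sh ins pl (fun _ _ _ _ => rfl) act (fun _ => rfl) r.continuous Φ hΦ
  rcases Nat.lt_or_ge w n with hwn | hnw
  · -- `w < n`: time slicing.  The conditional expectations of `F₁`, `F₂` given the slices
    obtain ⟨Ft₁, hFt₁⟩ : ∃ Ft₁ : (ZMod L → (ZMod L × Fin (M + 1) × Fin (M + 1)) × Fin 3 → G) → ℝ, ∀ V, Ft₁ V =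
        ∫ E, F₁ (asm (V, E)) * ∏ t ∈ Finset.univ.filter (fun t : ZMod L => (t - c).val ≤ w), q (V t) (E t) (V (t + 1))
          ∂(Measure.pi fun _ : ZMod L => Measure.pi fun _ : ZMod L × Fin (M + 1) × Fin (M + 1) =>
            Literature.MathematicalPhysics.QuantumFieldTheory.haarProbability G) := ⟨_, fun _ => rfl⟩
    obtain ⟨Ft₂, hFt₂⟩ : ∃ Ft₂ : (ZMod L → (ZMod L × Fin (M + 1) × Fin (M + 1)) × Fin 3 → G) → ℝ, ∀ V, Ft₂ V =
        ∫ E, F₂ (asm (V, E)) * ∏ t ∈ Finset.univ.filter (fun t : ZMod L => (t - c).val ≤ w), q (V t) (E t) (V (t + 1))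
          ∂(Measure.pi fun _ : ZMod L => Measure.pi fun _ : ZMod L × Fin (M + 1) × Fin (M + 1) =>
            Literature.MathematicalPhysics.QuantumFieldTheory.haarProbability G) := ⟨_, fun _ => rfl⟩
    have hLoc₁ := FreeTube.loc_condexp r.ρ β shS insS asm hasm Stm hStm q hq r.continuous c w F₁ hF₁m hF₁b hF₁l Ft₁ hFt₁
    have hLoc₂ := FreeTube.loc_condexp r.ρ β shS insS asm hasm Stm hStm q hq r.continuous c w F₂ hF₂m hF₂b hF₂l Ft₂ hFt₂
    obtain ⟨hP1, hP2, hP3⟩ := FreeTube.tube_pair_eq r.ρ β shS sh hsh0 hshs ins insS hins pl (fun _ _ _ _ => rfl) act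
      (fun _ => rfl) asm hasm Ssp hSsp Stm hStm K hK q hq r.continuous σ (fun _ _ _ => rfl) c w n hwn hn F₁ F₂ hF₁m hF₂m
      hF₁b hF₂b hF₁l hF₂l Ft₁ Ft₂ hFt₁ hFt₂
    -- vacuum dominance with a rate for the chain: the tube partition functions ARE the cyclic partition functions
    obtain ⟨lam, hlam, hlo, hup⟩ := hVDR L hLmin
    have hthr : 4 / m₀ * Real.log (2 + max C 0 * L) + 4 * (((w + 1 : ℕ) : ℝ) + 1) ≤ L := hL₁ L hLL₁
    have hCL : 0 ≤ max C 0 * (L : ℝ) := by positivity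
    have hZj : ∀ j : ℕ, (let St := ZMod (j + 1) × ZMod L × Fin (M + 1) × Fin (M + 1); let Cfg := St × Fin 4 → G;
        let ν : MeasureTheory.Measure Cfg := MeasureTheory.Measure.pi fun _ =>
          Literature.MathematicalPhysics.QuantumFieldTheory.haarProbability G;
        let sh : St → Fin 4 → St := fun x μ => ![(x.1 + 1, x.2.1, x.2.2.1, x.2.2.2), (x.1, x.2.1 + 1, x.2.2.1, x.2.2.2),
          (x.1, x.2.1, x.2.2.1 + 1, x.2.2.2), (x.1, x.2.1, x.2.2.1, x.2.2.2 + 1)] μ;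
        let ins : St → Fin 4 → Fin 4 → ℝ := fun x μ κ =>
          if ((μ = 2 ∨ κ = 2) → (x.2.2.1 : ℕ) < M) ∧ ((μ = 3 ∨ κ = 3) → (x.2.2.2 : ℕ) < M) then 1 else 0;
        let pl : Cfg → St → Fin 4 → Fin 4 → G := fun U x μ κ => U (x, μ) * U (sh x μ, κ) * (U (sh x κ, μ))⁻¹ * (U (x, κ))⁻¹;
        let act : Cfg → ℝ := fun U => β * ∑ x : St, ∑ q : {q : Fin 4 × Fin 4 // q.1 < q.2},
          ins x q.1.1 q.1.2 * (r.ρ (pl U x q.1.1 q.1.2)).trace.re;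
        ∫ U, Real.exp (act U) ∂ν) = ∫ V : ZMod (j + 1) → (ZMod L × Fin (M + 1) × Fin (M + 1)) × Fin 3 → G,
          ∏ t, K (V t) (V (t + 1)) ∂(Measure.pi fun _ => Measure.pi fun _ =>
            Literature.MathematicalPhysics.QuantumFieldTheory.haarProbability G) := fun j =>
      FreeTube.integral_exp_act_eq (T := j + 1) r.ρ β shS
        (fun x μ => ![(x.1 + 1, x.2.1, x.2.2.1, x.2.2.2), (x.1, x.2.1 + 1, x.2.2.1, x.2.2.2),
          (x.1, x.2.1, x.2.2.1 + 1, x.2.2.2), (x.1, x.2.1, x.2.2.1, x.2.2.2 + 1)] μ)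
        (fun _ _ => rfl) (fun t s i => by rw [hshS]; fin_cases i <;> rfl)
        (fun x μ κ => if ((μ = 2 ∨ κ = 2) → (x.2.2.1 : ℕ) < M) ∧ ((μ = 3 ∨ κ = 3) → (x.2.2.2 : ℕ) < M) then 1 else 0)
        insS (fun t s μ κ => by rw [hinsS]) _ (fun _ _ _ _ => rfl) _ (fun _ => rfl) _ (fun _ _ => rfl)
        Ssp hSsp Stm hStm K hK q hq r.continuous
    have key : |(∫ V, Ft₁ V * Ft₂ (fun t => V (t + n)) * ∏ t, K (V t) (V (t + 1)) ∂(Measure.pi fun _ : ZMod L =>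
          Measure.pi fun _ : (ZMod L × Fin (M + 1) × Fin (M + 1)) × Fin 3 =>
            Literature.MathematicalPhysics.QuantumFieldTheory.haarProbability G)) /
          (∫ V, ∏ t, K (V t) (V (t + 1)) ∂(Measure.pi fun _ : ZMod L =>
            Measure.pi fun _ : (ZMod L × Fin (M + 1) × Fin (M + 1)) × Fin 3 =>
              Literature.MathematicalPhysics.QuantumFieldTheory.haarProbability G)) -
        (∫ V, Ft₁ V * ∏ t, K (V t) (V (t + 1)) ∂(Measure.pi fun _ : ZMod L =>
          Measure.pi fun _ : (ZMod L × Fin (M + 1) × Fin (M + 1)) × Fin 3 =>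
            Literature.MathematicalPhysics.QuantumFieldTheory.haarProbability G)) /
          (∫ V, ∏ t, K (V t) (V (t + 1)) ∂(Measure.pi fun _ : ZMod L =>
            Measure.pi fun _ : (ZMod L × Fin (M + 1) × Fin (M + 1)) × Fin 3 =>
              Literature.MathematicalPhysics.QuantumFieldTheory.haarProbability G)) *
        ((∫ V, Ft₂ (fun t => V (t + n)) * ∏ t, K (V t) (V (t + 1)) ∂(Measure.pi fun _ : ZMod L =>
          Measure.pi fun _ : (ZMod L × Fin (M + 1) × Fin (M + 1)) × Fin 3 =>
            Literature.MathematicalPhysics.QuantumFieldTheory.haarProbability G)) /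
          (∫ V, ∏ t, K (V t) (V (t + 1)) ∂(Measure.pi fun _ : ZMod L =>
            Measure.pi fun _ : (ZMod L × Fin (M + 1) × Fin (M + 1)) × Fin 3 =>
              Literature.MathematicalPhysics.QuantumFieldTheory.haarProbability G)))| ≤
        64 * Real.exp (m₀ * (((w + 1 : ℕ) : ℝ) + 1)) * Real.exp (-(m₀ / 2 * n)) := by
      refine hS2a ((ZMod L × Fin (M + 1) × Fin (M + 1)) × Fin 3 → G)
        (Measure.pi fun _ : (ZMod L × Fin (M + 1) × Fin (M + 1)) × Fin 3 =>
          Literature.MathematicalPhysics.QuantumFieldTheory.haarProbability G) K hKm hKb hK0 hKs hKp m₀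
        (max C 0 * L) (w + 1) L hm₀ hCL hthr ⟨lam, hlam, fun j hj => ?_, fun j hj hjL => ?_⟩ c Ft₁ Ft₂ hLoc₁ hLoc₂ n hn
      · exact (hlo j hj).trans_eq (hZj j)
      · refine ((hZj j).symm.trans_le (hup j hj hjL)).trans ?_
        refine mul_le_mul_of_nonneg_left (Real.exp_le_exp.2 ?_) (pow_nonneg hlam.le _)
        exact mul_le_mul_of_nonneg_right (mul_le_mul_of_nonneg_right (le_max_left _ _) (Nat.cast_nonneg _))
          (Real.exp_pos _).le
    -- the three tube expectations are the chain expectations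
    have hP1' : ∫ U, F₁ U * F₂ (σ n U) * wgt U ∂ν = _ := hP1
    have hP2' : ∫ U, F₁ U * wgt U ∂ν = _ := hP2
    have hP3' : ∫ U, F₂ (σ n U) * wgt U ∂ν = _ := hP3
    have hE1 : Ex (fun U => F₁ U * F₂ (σ n U)) = (∫ V, Ft₁ V * Ft₂ (fun t => V (t + n)) * ∏ t, K (V t) (V (t + 1))
        ∂(Measure.pi fun _ : ZMod L => Measure.pi fun _ : (ZMod L × Fin (M + 1) × Fin (M + 1)) × Fin 3 =>
          Literature.MathematicalPhysics.QuantumFieldTheory.haarProbability G)) /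
          (∫ V, ∏ t, K (V t) (V (t + 1)) ∂(Measure.pi fun _ : ZMod L =>
            Measure.pi fun _ : (ZMod L × Fin (M + 1) × Fin (M + 1)) × Fin 3 =>
              Literature.MathematicalPhysics.QuantumFieldTheory.haarProbability G)) := by
      show (∫ U, F₁ U * F₂ (σ n U) * wgt U ∂ν) / (∫ U, wgt U ∂ν) = _
      rw [hP1', hZ]
    have hE2 : Ex F₁ = (∫ V, Ft₁ V * ∏ t, K (V t) (V (t + 1)) ∂(Measure.pi fun _ : ZMod L =>
        Measure.pi fun _ : (ZMod L × Fin (M + 1) × Fin (M + 1)) × Fin 3 =>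
          Literature.MathematicalPhysics.QuantumFieldTheory.haarProbability G)) /
          (∫ V, ∏ t, K (V t) (V (t + 1)) ∂(Measure.pi fun _ : ZMod L =>
            Measure.pi fun _ : (ZMod L × Fin (M + 1) × Fin (M + 1)) × Fin 3 =>
              Literature.MathematicalPhysics.QuantumFieldTheory.haarProbability G)) := by
      show (∫ U, F₁ U * wgt U ∂ν) / (∫ U, wgt U ∂ν) = _
      rw [hP2', hZ]
    have hE3 : Ex (fun U => F₂ (σ n U)) = (∫ V, Ft₂ (fun t => V (t + n)) * ∏ t, K (V t) (V (t + 1))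
        ∂(Measure.pi fun _ : ZMod L => Measure.pi fun _ : (ZMod L × Fin (M + 1) × Fin (M + 1)) × Fin 3 =>
          Literature.MathematicalPhysics.QuantumFieldTheory.haarProbability G)) /
          (∫ V, ∏ t, K (V t) (V (t + 1)) ∂(Measure.pi fun _ : ZMod L =>
            Measure.pi fun _ : (ZMod L × Fin (M + 1) × Fin (M + 1)) × Fin 3 =>
              Literature.MathematicalPhysics.QuantumFieldTheory.haarProbability G)) := by
      show (∫ U, F₂ (σ n U) * wgt U ∂ν) / (∫ U, wgt U ∂ν) = _
      rw [hP3', hZ]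
    rw [hE1, hE2, hE3]
    exact key.trans (mul_le_mul_of_nonneg_right (le_max_left _ _) (Real.exp_pos _).le)
  · -- `n ≤ w`: the trivial bound `2 ≤ 2 e^{m₀ w/2} e^{-m₀ n/2}`
    have h1 : |Ex (fun U => F₁ U * F₂ (σ n U)) - Ex F₁ * Ex (fun U => F₂ (σ n U))| ≤ 2 := by
      have ha := hEx1 (fun U => F₁ U * F₂ (σ n U)) fun U => by
        rw [abs_mul]; exact mul_le_one₀ (hF₁b U) (abs_nonneg _) (hF₂b _)
      have hb : |Ex F₁ * Ex (fun U => F₂ (σ n U))| ≤ 1 := by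
        rw [abs_mul]; exact mul_le_one₀ (hEx1 F₁ hF₁b) (abs_nonneg _) (hEx1 _ fun U => hF₂b _)
      calc |Ex (fun U => F₁ U * F₂ (σ n U)) - Ex F₁ * Ex (fun U => F₂ (σ n U))|
          ≤ |Ex (fun U => F₁ U * F₂ (σ n U))| + |Ex F₁ * Ex (fun U => F₂ (σ n U))| := abs_sub _ _
        _ ≤ 1 + 1 := add_le_add ha hb
        _ = 2 := by norm_num
    refine h1.trans ?_
    calc (2 : ℝ) = 2 * Real.exp (m₀ / 2 * w) * Real.exp (-(m₀ / 2 * w)) := by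
          rw [mul_assoc, ← Real.exp_add, add_neg_cancel, Real.exp_zero, mul_one]
      _ ≤ 2 * Real.exp (m₀ / 2 * w) * Real.exp (-(m₀ / 2 * n)) := by
          refine mul_le_mul_of_nonneg_left (Real.exp_le_exp.2 (neg_le_neg ?_)) (by positivity)
          exact mul_le_mul_of_nonneg_left (Nat.cast_le.2 hnw) (by positivity)
      _ ≤ max (64 * Real.exp (m₀ * (((w + 1 : ℕ) : ℝ) + 1))) (2 * Real.exp (m₀ / 2 * w)) *
            Real.exp (-(m₀ / 2 * n)) := mul_le_mul_of_nonneg_right (le_max_right _ _) (Real.exp_pos _).le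

/-- **Stub S2b — time-slicing of the free tube (PACKAGING; registered form, lead reshape r2).** For every compact
simple `G`, faithful unitary `r`, fibre width `M`, coupling `β ≥ 0`, rate `m₀ > 0`, constant `C` and floor `L_min`:
vacuum dominance with rate `m₀` for the Wilson partition functions of the free tubes with time period `j+1 ≥ 2` and
space period `L ≥ L_min` (the VDR clause of stub S1) implies, for every slab width `w`, the crux's clustering clause
`Tube M β (m₀/2) C' w L_min'` for some `C'`, `L_min'`. Proof: the conditional form applied to the landed abstract
theorem `stub_traceFormulaClustering` (p162688). [cite: OsterwalderSeiler1978, §2] [cite: Seiler1982, Ch. 2] -/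
theorem stub_tracePackaging :
    ∀ (G : Type) [Group G] [TopologicalSpace G] [IsTopologicalGroup G] [CompactSpace G], Literature.MathematicalPhysics.QuantumFieldTheory.IsCompactSimpleLieGroup G → letI : MeasurableSpace G := borel G; haveI : BorelSpace G := ⟨rfl⟩; ∀ r : Literature.MathematicalPhysics.QuantumFieldTheory.LatticeRep G, let Tube := fun (M : ℕ) (β m C : ℝ) (w Lmin : ℕ) => ∀ (L : ℕ) [NeZero L], Lmin ≤ L → let St := ZMod L × ZMod L × Fin (M + 1) × Fin (M + 1); let Cfg := St × Fin 4 → G; let ν : MeasureTheory.Measure Cfg := MeasureTheory.Measure.pi fun _ => Literature.MathematicalPhysics.QuantumFieldTheory.haarProbability G; let sh : St → Fin 4 → St := fun x μ => ![(x.1 + 1, x.2.1, x.2.2.1, x.2.2.2), (x.1, x.2.1 + 1, x.2.2.1, x.2.2.2), (x.1, x.2.1, x.2.2.1 + 1, x.2.2.2), (x.1, x.2.1, x.2.2.1, x.2.2.2 + 1)] μ; let ins : St → Fin 4 → Fin 4 → ℝ := fun x μ κ => if ((μ = 2 ∨ κ = 2) → (x.2.2.1 : ℕ) < M) ∧ ((μ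 = 3 ∨ κ = 3) → (x.2.2.2 : ℕ) < M) then 1 else 0; let pl : Cfg → St → Fin 4 → Fin 4 → G := fun U x μ κ => U (x, μ) * U (sh x μ, κ) * (U (sh x κ, μ))⁻¹ * (U (x, κ))⁻¹; let act : Cfg → ℝ := fun U => β * ∑ x : St, ∑ q : {q : Fin 4 × Fin 4 // q.1 < q.2}, ins x q.1.1 q.1.2 * (r.ρ (pl U x q.1.1 q.1.2)).trace.re; let wgt : Cfg → ℝ := fun U => Real.exp (act U); let Ex : (Cfg → ℝ) → ℝ := fun F => (∫ U, F U * wgt U ∂ν) / (∫ U, wgt U ∂ν); let σ : ℕ → Cfg → Cfg := fun n U p => U ((p.1.1 + n, p.1.2), p.2); ∀ c : ZMod L, let Loc := fun F : Cfg → ℝ => Measurable F ∧ (∀ U, |F U| ≤ 1) ∧ ∀ U U', (∀ p : St × Fin 4, (p.1.1 - c).val ≤ w → U p = U' p) → F U = F U'; ∀ F₁ F₂ : Cfg → ℝ, Loc F₁ → Loc F₂ → ∀ n : ℕ, 2 * n < L → |Ex (fun U => F₁ U * F₂ (σ n U)) - Ex F₁ * Ex (fun U => F₂ (σ n U))| ≤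 C * Real.exp (-(m * n)); let VDR := fun (M : ℕ) (β m₀ C : ℝ) (Lmin : ℕ) => ∀ (L : ℕ) [NeZero L], Lmin ≤ L → let Zt : ℕ → ℝ := fun j => let St := ZMod (j + 1) × ZMod L × Fin (M + 1) × Fin (M + 1); let Cfg := St × Fin 4 → G; let ν : MeasureTheory.Measure Cfg := MeasureTheory.Measure.pi fun _ => Literature.MathematicalPhysics.QuantumFieldTheory.haarProbability G; let sh : St → Fin 4 → St := fun x μ => ![(x.1 + 1, x.2.1, x.2.2.1, x.2.2.2), (x.1, x.2.1 + 1, x.2.2.1, x.2.2.2), (x.1, x.2.1, x.2.2.1 + 1, x.2.2.2), (x.1, x.2.1, x.2.2.1, x.2.2.2 + 1)] μ; let ins : St → Fin 4 → Fin 4 → ℝ := fun x μ κ => if ((μ = 2 ∨ κ = 2) → (x.2.2.1 : ℕ) < M) ∧ ((μ = 3 ∨ κ = 3) → (x.2.2.2 : ℕ) < M) then 1 else 0; let pl : Cfg → St → Fin 4 → Fin 4 → G := fun U x μ κ => U (x, μ) * U (sh x μ, κ) * (U (sh x κ, μ))⁻¹ * (U (x, κ))⁻¹; let act : Cfg → ℝ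 := fun U => β * ∑ x : St, ∑ q : {q : Fin 4 × Fin 4 // q.1 < q.2}, ins x q.1.1 q.1.2 * (r.ρ (pl U x q.1.1 q.1.2)).trace.re; ∫ U, Real.exp (act U) ∂ν; ∃ lam : ℝ, 0 < lam ∧ (∀ j : ℕ, 1 ≤ j → lam ^ (j + 1) ≤ Zt j) ∧ ∀ j : ℕ, 1 ≤ j → j + 1 ≤ L → Zt j ≤ lam ^ (j + 1) * Real.exp (C * (L : ℝ) * Real.exp (-(m₀ * (j + 1)))); ∀ (M : ℕ) (β m₀ C : ℝ) (Lmin : ℕ), 0 ≤ β → 0 < m₀ → VDR M β m₀ C Lmin → ∀ w : ℕ, ∃ C' : ℝ, ∃ Lmin' : ℕ, Tube M β (m₀ / 2) C' w Lmin' := by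
  exact stub_tracePackaging_of_traceFormulaClustering stub_traceFormulaClustering

end Summit.QuantumFields.YangMills.Cruxes.FibreAnchor.TraceVDR

end
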